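import Summits.BirchSwinnertonDyer.BirchSwinnertonDyer.Theorems.ClassRecordThreeEulerHalvesAtThreeCoStepLDefs
import HarnessLib

/-!
# Crux 19109 `EulerHalvesAtThree` — the residue in OUTPUT form: the missing upper bound on the residual Tamagawa class
# (tam3-p1 g19, after RULING 77 (c); companion of `Theorems/ClassRecordThreeEulerHalvesAtThreeCoStepLDefs.lean` §2–§4)

RULING 77 (plan g43, 2026-08-28T20:15Z) places the roads that attack the residue of crux 19109 as LINES on a residue crux. A line's
`_of` must CONCLUDE the crux decl, and the two roads in hand conclude DIFFERENT things: the co-STEP L input (item 23334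
`EulerHalvesAtThreeCoStepLResidual := Theorems.EulerHalvesAtThreeCoStepLResidual`) is the IMC «⊇» inequality `IMCUpperWaldspurgerOnTreeAt`
on every surj Heegner frame, converted INTO the Selmer bound `Typed.MissingUpperBoundAt W 3` by the co-chain theorems
(`Koly.missingUpperBoundAt_three_of_classX11b_of_ram_of_coStepLAt`, `Koly.missingUpperBoundAt_three_of_classX11b_of_surj_of_coStepLAt_of_twistLower`);
bsd-idea-10's CARTAN road OUTPUTS the Selmer bound directly (`CartanKernel.cartanRoadAtThree_of_inputs : CartanRoadAtThree`, p662140), and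
nothing in the tree or in print turns a bound back into the IMC inequality on frames — so the Cartan road cannot be a line on 23334.
The common TARGET of both roads is the BOUND on the residual class, stated here BY NAME (`Theorems.EulerHalvesAtThreeResidualUpperBound`),
with the residual class as one predicate (`Three.ResidualClassAt`), the output-form residue off a road (`Three.ResidualOffAt Φ`,
`Three.ResidualUpperBoundOffCartanAtThree`) and the two-stub bookkeeping (road + off-road residue ⟹ target). The implications that need
PRINT inputs (23334 ⟹ target; IMC-form off-Cartan residue ⟹ output-form; seven items ∧ target ⟹ crux 19109) are theorems of
`Theorems/ClassRecordThreeEulerHalvesAtThreeResidualUpperBoundClosers.lean`, not of this file.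

HONEST FRAMING: definitions and `Iff`∕monotonicity bookkeeping only; NOTHING asserted about any curve; the two closed `Prop` constants are
OPEN statements tagged `@[conjecture]` (closed constants only — RULING 75); crux 19109 and items 23334 ∕ 23176 ∕ 23177 ∕ 23178 stay as
filed; BSD is proved for no curve (T7).
-/

set_option linter.dupNamespace false
set_option autoImplicit false

noncomputable section

open scoped Classical

/-! ### §1. The residual class as one predicate; the output-form residue off a road -/

namespace Summit.BirchSwinnertonDyer.Rank1Residual.X11b.Three

open WeierstrassCurve Literature.NumberTheory.EllipticCurves.Rank1Residual
  Literature.NumberTheory.EllipticCurves.Rank1Residual.Typed Summit.BirchSwinnertonDyer.Rank1Residual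

variable {W : WeierstrassCurve ℚ} [W.IsElliptic] [W.IsGloballyMinimal]

/-- **`ResidualClassAt W`: the residual Tamagawa class of line `inert` as ONE predicate** — multi-carrier (`MultiCarrierAt W`) AND in
residual normal form (`ResidualNormalFormAt W`); the predicate `Φ` at which the road-agnostic composition (p658732) is instantiated to put
the OUTPUT-form residue below crux 19109 (its `hcoRes` binder is then vacuous). Decidable (Tate's algorithm); nothing asserted.
[cite: Jetchev2008, Thm. 1.4 and Cor. 1.5 (arXiv:math/0703431 p. 3) (the mono-carrier complement; shape only)] -/
def ResidualClassAt (W : WeierstrassCurve ℚ) [W.IsElliptic] [W.IsGloballyMinimal] : Prop :=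
  MultiCarrierAt W ∧ ResidualNormalFormAt W

/-- **`ResidualOffAt Φ W`: the residual class MINUS the `Φ`-servable curves** (output-form twin of the hypotheses of
`CoStepLResidualOffAtThree Φ`). Decidable when `Φ` is; nothing asserted. [folklore] -/
def ResidualOffAt (Φ : ∀ (W : WeierstrassCurve ℚ) [W.IsElliptic] [W.IsGloballyMinimal], Prop)
    (W : WeierstrassCurve ℚ) [W.IsElliptic] [W.IsGloballyMinimal] : Prop :=
  ResidualClassAt W ∧ ¬ Φ W

/-- Unfolding lemma. [folklore] -/
theorem residualClassAt_iff : ResidualClassAt W ↔ MultiCarrierAt W ∧ ResidualNormalFormAt W :=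
  Iff.rfl

/-- Unfolding lemma. [folklore] -/
theorem residualOffAt_iff (Φ : ∀ (W : WeierstrassCurve ℚ) [W.IsElliptic] [W.IsGloballyMinimal], Prop) :
    ResidualOffAt Φ W ↔ (MultiCarrierAt W ∧ ResidualNormalFormAt W) ∧ ¬ Φ W :=
  Iff.rfl

/-- **A road `Φ` and the OUTPUT-form residue off `Φ` give the missing upper bound on the whole residual class** (case split on the
decidable `Φ W`). Bookkeeping — the two-stub composition of every line on the output-form residue crux. [folklore] -/
theorem extraRoadAtThree_residualClassAt_of_road_of_off
    (Φ : ∀ (W : WeierstrassCurve ℚ) [W.IsElliptic] [W.IsGloballyMinimal], Prop)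
    (hRoad : ExtraRoadAtThree Φ) (hOff : ExtraRoadAtThree (ResidualOffAt Φ)) :
    ExtraRoadAtThree ResidualClassAt := by
  intro W _ _ hX hs hres
  by_cases hΦ : Φ W
  · exact hRoad W hX hs hΦ
  · exact hOff W hX hs ⟨hres, hΦ⟩

/-- Conversely the residual-class road serves the residue off any road (monotonicity). Bookkeeping. [folklore] -/
theorem extraRoadAtThree_residualOffAt_of_residualClassAt
    (Φ : ∀ (W : WeierstrassCurve ℚ) [W.IsElliptic] [W.IsGloballyMinimal], Prop)
    (h : ExtraRoadAtThree ResidualClassAt) : ExtraRoadAtThree (ResidualOffAt Φ) :=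
  extraRoadAtThree_mono (fun _ _ _ h' ↦ h'.1) h

/-- **The OUTPUT-form residue off the Cartan road, by name**: `ExtraRoadAtThree (ResidualOffAt CartanServableAtThree)` — the missing
upper bound at `3` on the surj X11b@3 curves of the residual class that are NOT Cartan-servable (ideator census, T7 evidence only:
9–36 of the 206 window-residue curves). Implied by the IMC-form `CoStepLResidualOffCartanAtThree` through the print inputs
(closers file); admits other roads (tam3-p1 g17's ramified-carrier frames (R1)). OPEN; nothing asserted.
[cite: KohenPacetti2016, Thm. 3.6, Thm. 3.7, Rem. 3.8 (the complement of the Cartan instance; shape only)] -/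
@[conjecture]
def ResidualUpperBoundOffCartanAtThree : Prop :=
  ExtraRoadAtThree (ResidualOffAt CartanServableAtThree)

end Summit.BirchSwinnertonDyer.Rank1Residual.X11b.Three

/-! ### §2. The output-form residue BY NAME (the constant the planner can item-state) and the two-stub cut -/

namespace Summit.BirchSwinnertonDyer.BirchSwinnertonDyer.Theorems

open Summit.BirchSwinnertonDyer.Rank1Residual Summit.BirchSwinnertonDyer.Rank1Residual.X11b.Three
  Literature.NumberTheory.EllipticCurves.Rank1Residual

/-- [OUTPUT-form residue of crux 19109 `EulerHalvesAtThree`, line `inert` r25] **the MISSING UPPER BOUND at 3 on the residual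
Tamagawa class (surj slice), for EVERY curve**: `∀ W, ClassX11b W 3 → Surj W 3 → MultiCarrierAt W → ResidualNormalFormAt W →
Typed.MissingUpperBoundAt W 3` — binder for binder the IMC-form item 23334 `EulerHalvesAtThreeCoStepLResidual` with its conclusion
`CoStepLAt W` replaced by the BOUND the crux actually consumes (and `ClassX11b W 3 → Surj W 3 →` prefixed, as in `ExtraRoadAtThree`).
The Theses-free constant the planner can item-state so that BOTH roads are lines on it: `costepl` (23334 ⟹ this, zero stubs, by the
co-chain conversions) and `cartan` (`CartanRoadAtThree` ∧ `ResidualUpperBoundOffCartanAtThree` ⟹ this,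
`eulerHalvesAtThreeResidualUpperBound_of_cartanRoad_of_offCartan`); crux 19109 ⟸ its seven other items ∧ this (p658732 at
`Φ := ResidualClassAt`, closers file). A `Prop` constant; OPEN (beyond print on whatever no road reaches); nothing asserted.
[cite: Castella2018, Thm. 3.2 (arXiv:1704.06608 p. 9) (shape of the IMC-form twin only; nothing asserted)] -/
@[conjecture]
def EulerHalvesAtThreeResidualUpperBound : Prop :=
  ∀ (W : WeierstrassCurve ℚ) [W.IsElliptic] [W.IsGloballyMinimal],
    ClassX11b W 3 → Surj W 3 → MultiCarrierAt W → ResidualNormalFormAt W → Typed.MissingUpperBoundAt W 3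

/-- `EulerHalvesAtThreeResidualUpperBound` is the road along the residual class (currying). Bookkeeping. [folklore] -/
theorem eulerHalvesAtThreeResidualUpperBound_iff_extraRoadAtThree :
    EulerHalvesAtThreeResidualUpperBound ↔ ExtraRoadAtThree ResidualClassAt :=
  ⟨fun h W _ _ hX hs hr ↦ h W hX hs hr.1 hr.2, fun h W _ _ hX hs hm hr ↦ h W hX hs ⟨hm, hr⟩⟩

/-- **Line `cartan`'s composition on the output-form residue**: the Cartan road and the output-form residue off it give the missing
upper bound on the whole residual class. Bookkeeping. [folklore] -/
theorem eulerHalvesAtThreeResidualUpperBound_of_cartanRoad_of_offCartan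
    (hRoad : CartanRoadAtThree) (hOff : ResidualUpperBoundOffCartanAtThree) : EulerHalvesAtThreeResidualUpperBound :=
  eulerHalvesAtThreeResidualUpperBound_iff_extraRoadAtThree.mpr
    (extraRoadAtThree_residualClassAt_of_road_of_off CartanServableAtThree hRoad hOff)

/-- **Any road `Φ` with its output-form off-road residue gives the output-form residue** (the generic two-stub cut; `Φ :=
CartanServableAtThree` is the previous lemma, g17's ramified-carrier frames would be another instance). Bookkeeping. [folklore] -/
theorem eulerHalvesAtThreeResidualUpperBound_of_road_of_off
    (Φ : ∀ (W : WeierstrassCurve ℚ) [W.IsElliptic] [W.IsGloballyMinimal], Prop)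
    (hRoad : ExtraRoadAtThree Φ) (hOff : ExtraRoadAtThree (ResidualOffAt Φ)) : EulerHalvesAtThreeResidualUpperBound :=
  eulerHalvesAtThreeResidualUpperBound_iff_extraRoadAtThree.mpr (extraRoadAtThree_residualClassAt_of_road_of_off Φ hRoad hOff)

end Summit.BirchSwinnertonDyer.BirchSwinnertonDyer.Theorems

end
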